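import Summits.KontsevichZagierPeriods.KontsevichZagierPeriods.Theorems.RootDecompWalshStrataBallChart
import Summits.KontsevichZagierPeriods.KontsevichZagierPeriods.Theorems.RootDecompWalshStrataAffineDescent01

/-!
# Affine descent on adapted atoms, part 2/2: `AffineDescent₂ K a b c` holds for every quadric normal form `K`

Declarations `Quadric₃.BxyP` … `affineDescent₂_holds` of the farm-checked gen-7 file (namespace `…ConicDescent.BallCube`,
over the landed `Quadric₃` / `adapted` / `atom` of `RootDecompWalshStrataBallChart`): the adapted functions as
polynomials over `ℚ` and as conics in the fibre variable (`Quadric₃.adaptedP`, `Quadric₃.conic`), the potential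
`affΦ = (a + b x) y + (c/2) y²`, the typed target `AffineDescent₂` (verbatim from the lens file §21) and the theorem
`affineDescent₂_holds : ∀ K a b c, AffineDescent₂ K a b c` (planar-sections engine + `InBaker.conic_section`).
See the module docstring of `RootDecompWalshStrataAffineDescent01` (part 1) for the overview and the sources.
[KontsevichZagier2001 §1.2; BCR1998 §2.2; this node gen 4–7]
-/

noncomputable section

open Literature.NumberTheory.Transcendental
open MeasureTheory Set
open MvPolynomial (aeval X C)
open Literature.ModelTheory.ExponentialFields (IsSemialgebraic isSemialgebraic_univ
  isSemialgebraic_setOf_eval_pos isSemialgebraic_setOf_eval_lt isSemialgebraic_setOf_eval_le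
  isSemialgebraic_setOf_eval_nonneg isSemialgebraic_setOf_eval_eq_zero
  isSemialgebraic_setOf_eval_ne_zero continuous_aeval_real tarski_seidenberg_real_holds)

namespace Summit.KontsevichZagierPeriods.RootDecompWalshStrata.ConicDescent.BallCube

/-! #### 26.3 The adapted functions: polynomials over `ℚ`, and conics in the fibre variable `y` -/

namespace Quadric₃

variable (K : Quadric₃)

/-- `B(x, y)` as a polynomial over `ℚ`. -/
def BxyP : MvPolynomial (Fin 2) ℚ := C K.b0 + C K.b1 * X 0 + C K.b2 * X 1

/-- `C(x, y)` as a polynomial over `ℚ`. -/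
def CxyP : MvPolynomial (Fin 2) ℚ :=
  C K.c0 + C K.c1 * X 0 + C K.c2 * X 1 + C K.c11 * X 0 ^ 2 + C K.c12 * X 0 * X 1 + C K.c22 * X 1 ^ 2

/-- The five adapted functions as polynomials over `ℚ`. -/
def adaptedP : Fin 5 → MvPolynomial (Fin 2) ℚ
  | ⟨0, _⟩ => K.BxyP ^ 2 - 4 * C K.A * K.CxyP
  | ⟨1, _⟩ => K.CxyP
  | ⟨2, _⟩ => C K.A + K.BxyP + K.CxyP
  | ⟨3, _⟩ => K.BxyP
  | ⟨_ + 4, _⟩ => 2 * C K.A + K.BxyP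

/-- Evaluation of `BxyP`. [this node] -/
@[simp] theorem aeval_BxyP (v : Fin 2 → ℝ) : aeval v K.BxyP = K.Bxy (v 0) (v 1) := by
  simp only [BxyP, Bxy, map_add, map_mul, MvPolynomial.aeval_C, MvPolynomial.aeval_X, eq_ratCast]

/-- Evaluation of `CxyP`. [this node] -/
@[simp] theorem aeval_CxyP (v : Fin 2 → ℝ) : aeval v K.CxyP = K.Cxy (v 0) (v 1) := by
  simp only [CxyP, Cxy, map_add, map_mul, map_pow, MvPolynomial.aeval_C, MvPolynomial.aeval_X,
    eq_ratCast]

/-- Evaluation of `adaptedP` is `adapted`. [this node] -/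
theorem aeval_adaptedP (i : Fin 5) (v : Fin 2 → ℝ) : aeval v (K.adaptedP i) = K.adapted i v := by
  fin_cases i
  · show aeval v (K.BxyP ^ 2 - 4 * C K.A * K.CxyP) = K.Dxy (v 0) (v 1)
    simp only [map_sub, map_mul, map_pow, map_ofNat, MvPolynomial.aeval_C, eq_ratCast, aeval_BxyP,
      aeval_CxyP, Dxy]
  · show aeval v K.CxyP = K.Cxy (v 0) (v 1)
    exact K.aeval_CxyP v
  · show aeval v (C K.A + K.BxyP + K.CxyP) = K.C1xy (v 0) (v 1)
    simp only [map_add, MvPolynomial.aeval_C, eq_ratCast, aeval_BxyP, aeval_CxyP, C1xy]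
  · show aeval v K.BxyP = K.Bxy (v 0) (v 1)
    exact K.aeval_BxyP v
  · show aeval v (2 * C K.A + K.BxyP) = 2 * K.A + K.Bxy (v 0) (v 1)
    simp only [map_add, map_mul, map_ofNat, MvPolynomial.aeval_C, eq_ratCast, aeval_BxyP]

/-- The adapted functions are continuous. [folklore] -/
theorem continuous_adapted (i : Fin 5) : Continuous (K.adapted i) :=
  (continuous_aeval_real (K.adaptedP i)).congr fun v => K.aeval_adaptedP i v

/-- The `i`-th adapted function as a CONIC in the fibre variable `y` over the base variable `x`
(`A y² + (b₀ + b₁ x) y + (c₀ + c₁ x + c₂ x²)`): `D`, `C₀`, `C₁`, `B`, `2A + B`. -/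
def conic : Fin 5 → Conic
  | ⟨0, _⟩ => ⟨K.b2 ^ 2 - 4 * K.A * K.c22, 2 * K.b2 * K.b0 - 4 * K.A * K.c2,
      2 * K.b2 * K.b1 - 4 * K.A * K.c12, K.b0 ^ 2 - 4 * K.A * K.c0, 2 * K.b0 * K.b1 - 4 * K.A * K.c1,
      K.b1 ^ 2 - 4 * K.A * K.c11⟩
  | ⟨1, _⟩ => ⟨K.c22, K.c2, K.c12, K.c0, K.c1, K.c11⟩
  | ⟨2, _⟩ => ⟨K.c22, K.b2 + K.c2, K.c12, K.A + K.b0 + K.c0, K.b1 + K.c1, K.c11⟩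
  | ⟨3, _⟩ => ⟨0, K.b2, 0, K.b0, K.b1, 0⟩
  | ⟨_ + 4, _⟩ => ⟨0, K.b2, 0, 2 * K.A + K.b0, K.b1, 0⟩

/-- The `i`-th adapted function is the `i`-th conic in `(x, y)`. [this node] -/
theorem adapted_eq_conic (i : Fin 5) (v : Fin 2 → ℝ) :
    K.adapted i v = (K.conic i).pxy (v 0) (v 1) := by
  fin_cases i
  · show K.Dxy (v 0) (v 1) = _
    simp only [conic, Dxy, Bxy, Cxy, Conic.pxy, Conic.Bx, Conic.Cx]; push_cast; ring
  · show K.Cxy (v 0) (v 1) = _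
    simp only [conic, Cxy, Conic.pxy, Conic.Bx, Conic.Cx]; ring
  · show K.C1xy (v 0) (v 1) = _
    simp only [conic, C1xy, Bxy, Cxy, Conic.pxy, Conic.Bx, Conic.Cx]; push_cast; ring
  · show K.Bxy (v 0) (v 1) = _
    simp only [conic, Bxy, Conic.pxy, Conic.Bx, Conic.Cx]; push_cast; ring
  · show 2 * (K.A : ℝ) + K.Bxy (v 0) (v 1) = _
    simp only [conic, Bxy, Conic.pxy, Conic.Bx, Conic.Cx]; push_cast; ring

end Quadric₃

/-! #### 26.4 The affine potential `Φ(x, y) = (a + b x) y + (c/2) y²` -/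

/-- The potential `Φ = (a + b x) y + (c/2) y²` with `∂Φ/∂y = a + b x + c y`, as a polynomial over `ℚ`. -/
def affΦ (a b c : ℚ) : MvPolynomial (Fin 2) ℚ := (C a + C b * X 0) * X 1 + C (c / 2) * X 1 ^ 2

/-- Evaluation of `affΦ`. [this node] -/
theorem aeval_affΦ (a b c : ℚ) (z : Fin 2 → ℝ) :
    aeval z (affΦ a b c) = ((a : ℝ) + b * z 0) * z 1 + (c : ℝ) / 2 * z 1 ^ 2 := by
  simp only [affΦ, map_add, map_mul, map_pow, MvPolynomial.aeval_C, MvPolynomial.aeval_X, eq_ratCast]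
  push_cast
  ring

/-- Evaluation of `affΦ` at a point `(x, t)` of a fibre (stated over `Fin (1 + 1)`, the index type the
planar-sections engine produces at `N = 1`). [this node] -/
theorem aeval_affΦ_snoc (a b c : ℚ) (x : Fin 1 → ℝ) (t : ℝ) :
    aeval (Fin.snoc x t : Fin (1 + 1) → ℝ) (affΦ a b c) = ((a : ℝ) + b * x 0) * t + (c : ℝ) / 2 * t ^ 2 := by
  rw [aeval_affΦ]; rfl

/-- `(x, t)₀ = x₀` on `Fin 2` (rfl helper; PRIVATE: landed twin `…MzvKernelInKZ.Negative.PiPolar.snoc2_zero`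
outside this chain, gate lint `dedup.landed`; QuadDescent03 keeps a private copy). [folklore] -/
@[simp] private theorem snoc_apply_zero₂ (x : Fin 1 → ℝ) (t : ℝ) :
    (Fin.snoc x t : Fin 2 → ℝ) 0 = x 0 := rfl

/-- `(x, t)₁ = t` on `Fin 2` (rfl helper; PRIVATE: landed twin `…PiPolar.snoc2_one`). [folklore] -/
@[simp] private theorem snoc_apply_one₂ (x : Fin 1 → ℝ) (t : ℝ) :
    (Fin.snoc x t : Fin 2 → ℝ) 1 = t := rfl

/-! #### 26.5 The typed target `AffineDescent₂` (lens file §21) and its proof -/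

/-- **Affine weights on adapted atoms** (the gen-5 companion statement of the node, typed in the lens
file `WalshStrata.lean` §21; second hypothesis of the typed glue `QuadricThreeReduction`):
`[atom, a + b x + c y]` lands in the Baker sector modulo relations for every atom of the adapted sign
algebra of a quadric normal form `K`.  PROVED below for all `K a b c` (`affineDescent₂_holds`).
[KontsevichZagier2001 §1.2; this node, gen 5 plan / gen 7] -/
def AffineDescent₂ (K : Quadric₃) (a b c : ℚ) : Prop :=
  ∀ (σ : Fin 5 → SignType) (r : KZ.IntegralRep 2), r.domain = K.atom σ →
    EqOn r.integrand (fun v => (a : ℝ) + b * v 0 + c * v 1) r.domain → InBaker (KZ.of r)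

/-- **`AffineDescent₂ K a b c` holds for every quadric normal form `K` and all `a b c ∈ ℚ`.**
Degenerate atoms are empty or null; a generic atom is open with frontier in the edges of the square
and the zero sets of the non-trivial adapted conics, and the planar-sections engine with the potential
`Φ = (a + b x) y + (c/2) y²` reduces `[atom, a + b x + c y]` to conic section terms
(`InBaker.conic_section`), edge terms (null / zero / polynomial). [KontsevichZagier2001 §1.2; this node gen 7] -/
theorem affineDescent₂_holds (K : Quadric₃) (a b c : ℚ) : AffineDescent₂ K a b c := by
  classical
  intro σ r hrd hri
  -- degenerate atoms: empty, or inside the zero set of a non-trivial adapted function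
  by_cases hemp : ∃ i, (∀ v, K.adapted i v = 0) ∧ σ i ≠ 0
  · obtain ⟨i, hi0, hσ⟩ := hemp
    refine InBaker.of_domain_eq_empty r ?_
    rw [hrd]
    refine eq_empty_of_forall_notMem fun v hv => hσ ?_
    rw [← hv.2 i, hi0 v, sign_zero]
  by_cases hnull : ∃ i, σ i = 0 ∧ ∃ v, K.adapted i v ≠ 0
  · obtain ⟨i, hσ, v, hv⟩ := hnull
    refine InBaker.of_subset_zeroSet r (K.adaptedP i) ⟨v, by rwa [K.aeval_adaptedP]⟩ fun x hx => ?_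
    rw [K.aeval_adaptedP]
    rw [hrd] at hx
    exact sign_eq_zero_iff.1 ((hx.2 i).trans hσ)
  -- generic atom: `σ i = 0` exactly for the identically vanishing adapted functions
  replace hemp : ∀ i, (∀ v, K.adapted i v = 0) → σ i = 0 := fun i hi =>
    by_contra fun hσ => hemp ⟨i, hi, hσ⟩
  replace hnull : ∀ i, σ i = 0 → ∀ v, K.adapted i v = 0 := fun i hσ v =>
    by_contra fun hv => hnull ⟨i, hσ, v, hv⟩
  have hsgn : ∀ s : SignType, s = 0 ∨ s = -1 ∨ s = 1 := fun s => by cases s <;> simp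
  have hcont := K.continuous_adapted
  have hWI : K.atom σ ⊆ Icc 0 1 := fun v hv => ⟨fun j => (hv.1 j).1.le, fun j => (hv.1 j).2.le⟩
  have hclI : closure (K.atom σ) ⊆ Icc 0 1 := closure_minimal hWI isClosed_Icc
  have hWs : IsSemialgebraic ℚ (K.atom σ) := hrd ▸ r.isSemialgebraic_domain
  have hWo : IsOpen (K.atom σ) := by
    have hWeq : K.atom σ = (⋂ j : Fin 2, {v : Fin 2 → ℝ | 0 < v j ∧ v j < 1}) ∩
        ⋂ i : Fin 5, {v | SignType.sign (K.adapted i v) = σ i} := by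
      ext v; simp only [Quadric₃.atom, mem_setOf_eq, mem_inter_iff, mem_iInter]
    rw [hWeq]
    refine (isOpen_iInter_of_finite fun j => ?_).inter (isOpen_iInter_of_finite fun i => ?_)
    · exact (isOpen_lt continuous_const (continuous_apply j)).inter
        (isOpen_lt (continuous_apply j) continuous_const)
    · rcases hsgn (σ i) with h | h | h
      · rw [show {v : Fin 2 → ℝ | SignType.sign (K.adapted i v) = σ i} = univ from
          eq_univ_of_forall fun v => by rw [mem_setOf_eq, hnull i h v, sign_zero, h]]
        exact isOpen_univ
      · simp only [h, sign_eq_neg_one_iff]; exact isOpen_lt (hcont i) continuous_const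
      · simp only [h, sign_eq_one_iff]; exact isOpen_lt continuous_const (hcont i)
  -- the frontier of a generic atom
  have hfront : ∀ z ∈ frontier (K.atom σ), (z 0 = 0 ∨ z 0 = 1) ∨ (z 1 = 0 ∨ z 1 = 1) ∨
      ∃ i, σ i ≠ 0 ∧ K.adapted i z = 0 := by
    intro z hz
    rw [hWo.frontier_eq] at hz
    obtain ⟨hzc, hzW⟩ := hz
    have hzI := hclI hzc
    by_contra hcon
    simp only [not_or, not_exists, not_and] at hcon
    obtain ⟨⟨h00, h01⟩, ⟨h10, h11⟩, had⟩ := hcon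
    have hcoord : ∀ j : Fin 2, z j ≠ 0 ∧ z j ≠ 1 := Fin.forall_fin_two.2 ⟨⟨h00, h01⟩, ⟨h10, h11⟩⟩
    apply hzW
    refine ⟨fun j => ⟨lt_of_le_of_ne (hzI.1 j) (hcoord j).1.symm, lt_of_le_of_ne (hzI.2 j) (hcoord j).2⟩,
      fun i => ?_⟩
    rcases hsgn (σ i) with h | h | h
    · rw [h, hnull i h z, sign_zero]
    · have hle : K.adapted i z ≤ 0 :=
        closure_minimal (fun v (hv : v ∈ K.atom σ) =>
          show v ∈ {v | K.adapted i v ≤ 0} from (sign_eq_neg_one_iff.1 ((hv.2 i).trans h)).le)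
          (isClosed_le (hcont i) continuous_const) hzc
      rw [h]
      exact sign_eq_neg_one_iff.2 (lt_of_le_of_ne hle (had i (by rw [h]; decide)))
    · have hle : 0 ≤ K.adapted i z :=
        closure_minimal (fun v (hv : v ∈ K.atom σ) =>
          show v ∈ {v | 0 ≤ K.adapted i v} from (sign_eq_one_iff.1 ((hv.2 i).trans h)).le)
          (isClosed_le continuous_const (hcont i)) hzc
      rw [h]
      exact sign_eq_one_iff.2 (lt_of_le_of_ne hle (fun h0 => had i (by rw [h]; decide) h0.symm))
  -- the engine
  refine InBaker.of_planar_sections (N := 1) hWo hWs hWI (fun z => aeval z (affΦ a b c))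
    (isSemialgebraicFunOn_aeval isSemialgebraic_univ _) (continuous_aeval_real _) r hrd
    (fun z hz => ?_) fun S ζ hS hζ hζc hgr r₁ hr₁d hr₁i => ?_
  · -- `∂Φ/∂y = a + b x + c y`
    have hz' : z ∈ r.domain := by rw [hrd]; exact hz
    have h := ((hasDerivAt_id (z 1)).const_mul ((a : ℝ) + b * z 0)).add
      (((hasDerivAt_id (z 1)).mul (hasDerivAt_id (z 1))).const_mul ((c : ℝ) / 2))
    rw [show z (Fin.last 1) = z 1 from rfl, hri hz']
    refine (h.congr_of_eventuallyEq (Filter.Eventually.of_forall fun s => ?_)).congr_deriv ?_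
    · rw [aeval_affΦ_snoc, show Fin.init z 0 = z 0 from rfl]
      simp only [Pi.add_apply, Pi.mul_apply, id]
      ring
    · simp only [id]
      ring
  · -- boundary sections
    have hSI : ∀ x ∈ S, (0 ≤ x 0 ∧ x 0 ≤ 1) ∧ (0 ≤ ζ x ∧ ζ x ≤ 1) := by
      intro x hx
      have h := hclI (frontier_subset_closure (hgr x hx))
      exact ⟨⟨by simpa using h.1 0, by simpa using h.2 0⟩, by simpa using h.1 1, by simpa using h.2 1⟩
    have hTI : ∀ T, T ⊆ S → T ⊆ Icc (0 : Fin 1 → ℝ) 1 := fun T hT x hx =>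
      ⟨fun j => by rw [Subsingleton.elim j 0]; exact (hSI x (hT hx)).1.1,
        fun j => by rw [Subsingleton.elim j 0]; exact (hSI x (hT hx)).1.2⟩
    have hrS : ∀ x ∈ S, r₁.integrand x = ((a : ℝ) + b * x 0) * ζ x + (c : ℝ) / 2 * ζ x ^ 2 := by
      intro x hx
      rw [hr₁i hx]
      beta_reduce
      rw [aeval_affΦ_snoc]
    -- the pieces: edges `x ∈ {0,1}`, `ζ = 0`, `ζ = 1`, and the conic branches `adapted i (x, ζ x) = 0`
    let E : Set (Fin 1 → ℝ) := {x | aeval x (X 0 * (X 0 - 1) : MvPolynomial (Fin 1) ℚ) = 0}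
    let Z0 : Set (Fin 1 → ℝ) := {x | x ∈ S ∧ ζ x = ((0 : ℚ) : ℝ)}
    let Z1 : Set (Fin 1 → ℝ) := {x | x ∈ S ∧ ζ x = ((1 : ℚ) : ℝ)}
    let Ad : Fin 5 → Set (Fin 1 → ℝ) := fun i =>
      {x | x ∈ S ∧ K.adapted i (Fin.snoc x (ζ x)) = 0 ∧ σ i ≠ 0}
    let A : Option (Option (Option (Fin 5))) → Set (Fin 1 → ℝ) := fun o =>
      o.elim E fun o' => o'.elim Z0 fun o'' => o''.elim Z1 Ad
    have hAd : ∀ i, IsSemialgebraic ℚ (Ad i) := by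
      intro i
      by_cases hσ : σ i = 0
      · have : Ad i = ∅ := eq_empty_of_forall_notMem fun x hx => hx.2.2 hσ
        rw [this]; exact Literature.ModelTheory.ExponentialFields.isSemialgebraic_empty
      · have hg : IsSemialgebraicFunOn ℚ S fun x => K.adapted i (Fin.snoc x (ζ x) : Fin 2 → ℝ) :=
          isSemialgebraicFunOn_comp_snoc (N := 1) hS
            ((isSemialgebraicFunOn_aeval isSemialgebraic_univ (K.adaptedP i)).congr
              fun v _ => K.aeval_adaptedP i v) hζ
        have := isSemialgebraic_sep_eq hg (isSemialgebraicFunOn_ratCast hS 0)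
        convert this using 1
        ext x
        simp only [Ad, mem_setOf_eq, Rat.cast_zero, hσ, ne_eq, not_false_eq_true, and_true]
    refine InBaker.of_cover' r₁ A ?_ ?_ ?_
    · rintro (_ | _ | _ | i)
      · exact isSemialgebraic_setOf_eval_eq_zero _
      · exact isSemialgebraic_sep_eq hζ (isSemialgebraicFunOn_ratCast hS 0)
      · exact isSemialgebraic_sep_eq hζ (isSemialgebraicFunOn_ratCast hS 1)
      · exact hAd i
    · intro x hx
      have hxS : x ∈ S := by rw [← hr₁d]; exact hx
      rcases hfront _ (hgr x hxS) with (h | h) | (h | h) | ⟨i, hσi, hi⟩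
      · refine mem_iUnion.2 ⟨none, ?_⟩
        have h' : x 0 = 0 := by simpa using h
        show aeval x (X 0 * (X 0 - 1) : MvPolynomial (Fin 1) ℚ) = 0
        simp [h']
      · refine mem_iUnion.2 ⟨none, ?_⟩
        have h' : x 0 = 1 := by simpa using h
        show aeval x (X 0 * (X 0 - 1) : MvPolynomial (Fin 1) ℚ) = 0
        simp [h']
      · exact mem_iUnion.2 ⟨some none, hxS, by simpa using h⟩
      · exact mem_iUnion.2 ⟨some (some none), hxS, by simpa using h⟩
      · exact mem_iUnion.2 ⟨some (some (some i)), hxS, hi, hσi⟩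
    · rintro (_ | _ | _ | i) T hT hTr hTA
      · -- edges: null
        exact InBaker.of_subset_zeroSet _ (X 0 * (X 0 - 1)) ⟨fun _ => 2, by norm_num⟩
          fun x hx => hTA hx
      · -- `ζ = 0`: zero integrand
        refine InBaker.of_mem_relations (KZ.of_mem_relations_of_eqOn_zero _ fun x hx => ?_)
        have hx' : x ∈ S ∧ ζ x = ((0 : ℚ) : ℝ) := hTA hx
        show r₁.integrand x = 0
        rw [hrS x hx'.1, hx'.2, Rat.cast_zero]
        ring
      · -- `ζ = 1`: polynomial integrand
        refine InBaker.of_eqOn_aeval _ (C (a + c / 2) + C b * X 0) fun x hx => ?_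
        have hx' : x ∈ S ∧ ζ x = ((1 : ℚ) : ℝ) := hTA hx
        show r₁.integrand x = _
        rw [hrS x hx'.1, hx'.2, Rat.cast_one]
        simp only [map_add, map_mul, MvPolynomial.aeval_C, MvPolynomial.aeval_X, eq_ratCast]
        push_cast
        ring
      · -- the conic branch `adapted i (x, ζ x) = 0`, `σ i ≠ 0`
        by_cases hT0 : T = ∅
        · exact InBaker.of_domain_eq_empty _ hT0
        obtain ⟨x₀, hx₀⟩ := nonempty_iff_ne_empty.2 hT0
        have hTS : T ⊆ S := fun x hx => (hTA hx).1
        have hσi : σ i ≠ 0 := (hTA hx₀).2.2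
        have hQ : ∃ x y : ℝ, (K.conic i).pxy x y ≠ 0 := by
          by_contra h
          exact hσi (hemp i fun v => by
            rw [K.adapted_eq_conic]; exact by_contra fun hne => h ⟨_, _, hne⟩)
        refine InBaker.conic_section (K.conic i) hQ a b c (r₁.restrict T hT hTr) (hTI T hTS) ζ
          (hζ.mono hTS hT) (fun v hv => ?_) fun v hv => hrS v (hTS hv)
        have h := (hTA hv).2.1
        rwa [K.adapted_eq_conic, snoc_apply_zero₂, snoc_apply_one₂] at h

end Summit.KontsevichZagierPeriods.RootDecompWalshStrata.ConicDescent.BallCube
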